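import Summits.QuantumFields.BalabanUV.Beta.AxialProjectorBlockMean
import Summits.QuantumFields.BalabanUV.Beta.AxialDressingRootedReflection

/-!
# PREPARATORY (pending β-lead RULING (R42-1); touches NO wall object): the matrix `pmBm` of the BLOCK-MEAN-normalised rooted
# projector `axProjBmAt` and its SUPPORT — the window of part 1 carries it too

HONEST FRAMING (cell charter, verbatim): «discharging BetaPertH makes Balaban's UV stability UNCONDITIONAL — a real
constructive-QFT result; it is NOT the continuum limit and NOT the Clay problem.»  DERIVED cell leaf (β sub-cell, lane an2 gen 12,
NOTE X-an2-42 §4(d) «what survives»); no statement of Bałaban's papers, no `[cite:]` tag, no `Prop` fact; instantiates no wall binder.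
NOT `BetaPertH`; NOT continuum; NOT Clay.

## What is here
* §1 `pmBm ρ N β p α q : ℝ := axProjBmAt ρ N (real indicator of (α,q)) β p` = `pm + (block-mean step of the tree integral of the indicator)`
  (`pmBm_eq`); `blockSum_treeGaugeAt_bondInd_ne_zero` (a block whose tree-integral block sum of `δ_{(α,q)}` is non-zero CONTAINS the bond);
  **`pmBm_ne_zero`** — the SAME support conclusion as part 7's `pm_ne_zero` (`|p_i − q_i| ≤ N−1` off the leg axis, `−N ≤ p_b − q_b ≤ N−1`),
  hence `window_of_pmBm_ne_zero`, `window_refl_of_pmBm_ne_zero` verbatim.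
So the windowed-kernel construction of parts 4–8 (`piK`, `dressKAt = piK∘K∘piKᵀ`, `TbalOf_dressAt`, `refK_piK`, rules 1–2, the wiring) can be
re-issued over `pmBm` with unchanged window bookkeeping, IF the lead rules to re-base the dressing (X-an2-42 (R42-1)).
All declarations `[folklore]`; axioms standard.  Provenance: b2b-balaban β sub-cell, unit beta-an2 gen 12, 2026-08-19 (v1).
-/

open Finset
open scoped BigOperators
open Literature.MathematicalPhysics.QuantumFieldTheory
open Literature.MathematicalPhysics.QuantumFieldTheory.Balaban1983to89
open Literature.MathematicalPhysics.QuantumFieldTheory.Balaban1983to89.Beta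
open AffineAveraging (Form0 Form1 box toSite unitVec unitVec_apply blockSum)
open AveragingContours (blk grad axial)
open AveragingContoursRooted (treeGaugeAt)
open RootedComb (axProjAt axProjAt_apply)
open AxialProjector (zsmul_blk_le lt_zsmul_blk_add)
open ResolventReflection (bref bref_apply)
open Summit.QuantumFields.BalabanUV.Beta.AxialProjectorBlockMean (blockMeanAt axProjBmAt axProjBmAt_eq)

namespace Summit.QuantumFields.BalabanUV.Beta.AxialDressingRooted

noncomputable section

variable {n : ℕ}

/-! ## §1 The matrix of `Π_bm` and its support -/

/-- [folklore] **THE MATRIX OF THE BLOCK-MEAN-NORMALISED ROOTED PROJECTOR** (real-valued): `pmBm ρ N β p α q := (Π^ρ_bm δ_{(α,q)})_β(p)`. -/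
def pmBm (ρ : Fin n → ℤ) (N : ℕ) (β : Fin n) (p : Fin n → ℤ) (α : Fin n) (q : Fin n → ℤ) : ℝ :=
  axProjBmAt ρ N (fun κ z => (bondInd α q κ z : ℝ)) β p

/-- [folklore] `pmBm = pm + (the block-mean step of the tree integral of the indicator across the leg)`. -/
theorem pmBm_eq (ρ : Fin n → ℤ) (N : ℕ) (β : Fin n) (p : Fin n → ℤ) (α : Fin n) (q : Fin n → ℤ) :
    pmBm ρ N β p α q = (pm ρ N β p α q : ℝ) +
      (blockMeanAt N (treeGaugeAt ρ (fun κ z => (bondInd α q κ z : ℝ)) N) (p + unitVec β) -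
        blockMeanAt N (treeGaugeAt ρ (fun κ z => (bondInd α q κ z : ℝ)) N) p) := by
  unfold pmBm
  rw [axProjBmAt_eq, Pi.add_apply, Pi.add_apply, ← pm_cast]
  rfl

/-- [folklore] BLOCK form of part 7's `treeGaugeAt_bondInd_ne_zero`: if `treeGaugeAt (toSite r) (bondInd a q) N p ≠ 0` then the bond
`(a, q)` lies in the BLOCK of `p` (both endpoints), coordinatewise. -/
theorem treeGaugeAt_bondInd_ne_zero_blk {N : ℕ} (hN : 1 ≤ N) {r : Fin n → ℕ} (hr : r ∈ box n N) {a : Fin n}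
    {q p : Fin n → ℤ} (h : treeGaugeAt (toSite r) (bondInd a q) N p ≠ 0) (j : Fin n) :
    ((N : ℤ) • blk N p) j ≤ q j ∧ q j ≤ ((N : ℤ) • blk N p) j + N - 1 ∧
      ((N : ℤ) • blk N p) j ≤ q j + (if j = a then 1 else 0) ∧ q j + (if j = a then 1 else 0) ≤ ((N : ℤ) • blk N p) j + N - 1 := by
  unfold treeGaugeAt at h
  obtain ⟨c, hc, hc0⟩ := exists_mem_ne_zero_of_sum_ne_zero h
  obtain ⟨κ, z', e, hz, hz'⟩ := mem_axial_hull hc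
  have hκq : κ = a ∧ z' = q := by
    by_contra hne
    have h0 : bondInd a q κ z' = 0 := by
      rw [bondInd_apply, if_neg]
      exact fun h' => hne ⟨h'.1, h'.2⟩
    rcases e with e | e
    · exact hc0 (by rw [e, h0])
    · exact hc0 (by rw [e, h0, neg_zero])
  obtain ⟨hκa, hzq⟩ := hκq
  rw [hzq] at hz hz'
  rw [hκa] at hz'
  have hrj : ((r j : ℕ) : ℤ) < N := by exact_mod_cast Finset.mem_range.1 (Fintype.mem_piFinset.1 hr j)
  have hr0 : (0 : ℤ) ≤ (r j : ℕ) := by positivity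
  have a1 := zsmul_blk_le hN p j
  have a2 := lt_zsmul_blk_add hN p j
  have eroot : ((N : ℤ) • blk N p + toSite r) j = ((N : ℤ) • blk N p) j + ((r j : ℕ) : ℤ) := by
    simp only [Pi.add_apply, toSite]
  have b1 := InHull.bounds hz (j := j) (L := ((N : ℤ) • blk N p) j) (U := ((N : ℤ) • blk N p) j + N - 1)
    (by rw [eroot]; omega) (by rw [eroot]; omega) a1 (by omega)
  have b2 := InHull.bounds hz' (j := j) (L := ((N : ℤ) • blk N p) j) (U := ((N : ℤ) • blk N p) j + N - 1)
    (by rw [eroot]; omega) (by rw [eroot]; omega) a1 (by omega)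
  simp only [Pi.add_apply, unitVec_apply] at b2
  exact ⟨b1.1, b1.2, b2.1, b2.2⟩

/-- [folklore] **A BLOCK WHOSE TREE-INTEGRAL BLOCK SUM OF `δ_{(a,q)}` IS NON-ZERO CONTAINS THE BOND** (in-block root): for every `j`,
`N•y_j ≤ q_j ≤ N•y_j + N − 1` and the same for `q + e_a`. -/
theorem blockSum_treeGaugeAt_bondInd_ne_zero {N : ℕ} (hN : 1 ≤ N) {r : Fin n → ℕ} (hr : r ∈ box n N) {a : Fin n}
    {q : Fin n → ℤ} {y : Fin n → ℤ} (h : blockSum N (treeGaugeAt (toSite r) (fun κ z => (bondInd a q κ z : ℝ)) N) y ≠ 0)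
    (j : Fin n) :
    ((N : ℤ) • y) j ≤ q j ∧ q j ≤ ((N : ℤ) • y) j + N - 1 ∧
      ((N : ℤ) • y) j ≤ q j + (if j = a then 1 else 0) ∧ q j + (if j = a then 1 else 0) ≤ ((N : ℤ) • y) j + N - 1 := by
  obtain ⟨b, hb, hb0⟩ := Finset.exists_ne_zero_of_sum_ne_zero h
  have hcast : treeGaugeAt (toSite r) (fun κ z => (bondInd a q κ z : ℝ)) N ((N : ℤ) • y + toSite b) =
      ((treeGaugeAt (toSite r) (bondInd a q) N ((N : ℤ) • y + toSite b) : ℤ) : ℝ) :=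
    treeGaugeAt_map (Int.castAddHom ℝ) (toSite r) (bondInd a q) N _
  rw [hcast] at hb0
  have hz : treeGaugeAt (toSite r) (bondInd a q) N ((N : ℤ) • y + toSite b) ≠ 0 := fun e => hb0 (by rw [e, Int.cast_zero])
  have k := treeGaugeAt_bondInd_ne_zero_blk hN hr hz j
  rw [AveragingContours.blk_block y hb] at k
  exact k

/-- [folklore] **SUPPORT OF `pmBm`** (in-block root): `pmBm (toSite r) N b p a q ≠ 0` forces `|p_i − q_i| ≤ N − 1` for `i ≠ b` and
`−N ≤ p_b − q_b ≤ N − 1` — the conclusion of part 7's `pm_ne_zero` VERBATIM. -/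
theorem pmBm_ne_zero {N : ℕ} (hN : 1 ≤ N) {r : Fin n → ℕ} (hr : r ∈ box n N) {b : Fin n} {p : Fin n → ℤ} {a : Fin n}
    {q : Fin n → ℤ} (h : pmBm (toSite r) N b p a q ≠ 0) (i : Fin n) :
    (i ≠ b → |p i - q i| ≤ (N : ℤ) - 1) ∧ (-(N : ℤ) ≤ p i - q i ∧ p i - q i ≤ (N : ℤ) - 1) := by
  rw [pmBm_eq] at h
  by_cases hpm : pm (toSite r) N b p a q ≠ 0
  · exact pm_ne_zero hN hr hpm i
  · have hpm' : (pm (toSite r) N b p a q : ℝ) = 0 := by rw [not_ne_iff.1 hpm, Int.cast_zero]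
    rw [hpm', zero_add] at h
    -- one of the two block means is non-zero
    have hNn : ((N : ℝ) ^ n) ≠ 0 := pow_ne_zero _ (by exact_mod_cast (show N ≠ 0 by omega))
    by_cases h1 : blockSum N (treeGaugeAt (toSite r) (fun κ z => (bondInd a q κ z : ℝ)) N) (blk N (p + unitVec b)) ≠ 0
    · have k := blockSum_treeGaugeAt_bondInd_ne_zero hN hr h1 i
      have a1 := zsmul_blk_le hN (p + unitVec b) i
      have a2 := lt_zsmul_blk_add hN (p + unitVec b) i
      simp only [Pi.add_apply, unitVec_apply] at a1 a2
      obtain ⟨k1, k2, k3, k4⟩ := k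
      refine ⟨fun hib => ?_, ?_, ?_⟩
      · rw [if_neg hib] at a1 a2; rw [abs_le]; by_cases hia : i = a
        · rw [if_pos hia] at k3 k4; constructor <;> omega
        · rw [if_neg hia] at k3 k4; constructor <;> omega
      · by_cases hib : i = b
        · rw [if_pos hib] at a1 a2
          by_cases hia : i = a
          · rw [if_pos hia] at k3 k4; omega
          · rw [if_neg hia] at k3 k4; omega
        · rw [if_neg hib] at a1 a2; omega
      · by_cases hib : i = b
        · rw [if_pos hib] at a1 a2
          by_cases hia : i = a
          · rw [if_pos hia] at k3 k4; omega
          · rw [if_neg hia] at k3 k4; omega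
        · rw [if_neg hib] at a1 a2
          by_cases hia : i = a
          · rw [if_pos hia] at k3 k4; omega
          · rw [if_neg hia] at k3 k4; omega
    · have h1' : blockSum N (treeGaugeAt (toSite r) (fun κ z => (bondInd a q κ z : ℝ)) N) (blk N (p + unitVec b)) = 0 :=
        not_ne_iff.1 h1
      have h2 : blockSum N (treeGaugeAt (toSite r) (fun κ z => (bondInd a q κ z : ℝ)) N) (blk N p) ≠ 0 := by
        intro e
        apply h
        unfold blockMeanAt
        rw [h1', e]
        simp
      have k := blockSum_treeGaugeAt_bondInd_ne_zero hN hr h2 i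
      have a1 := zsmul_blk_le hN p i
      have a2 := lt_zsmul_blk_add hN p i
      obtain ⟨k1, k2, k3, k4⟩ := k
      have hN1 : (1 : ℤ) ≤ N := by exact_mod_cast hN
      refine ⟨fun _ => ?_, ?_, ?_⟩
      · rw [abs_le]; constructor <;> omega
      · omega
      · omega

/-- [folklore] The window of part 1 carries `pmBm`: `pmBm ≠ 0 ⇒ p − q ∈ cube`. -/
theorem window_of_pmBm_ne_zero {N : ℕ} (hN : 1 ≤ N) {r : Fin n → ℕ} (hr : r ∈ box n N) {b : Fin n} {p : Fin n → ℤ}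
    {a : Fin n} {q : Fin n → ℤ} (h : pmBm (toSite r) N b p a q ≠ 0) : p - q ∈ cube n N := by
  rw [mem_cube]
  intro i
  have k := (pmBm_ne_zero hN hr h i).2
  rw [Pi.sub_apply, abs_le]
  constructor <;> omega

/-- [folklore] … and its axis-reflected image: `pmBm ≠ 0 ⇒ bref α b p − bref α a q ∈ cube`. -/
theorem window_refl_of_pmBm_ne_zero {N : ℕ} (hN : 1 ≤ N) {r : Fin n → ℕ} (hr : r ∈ box n N) {b : Fin n} {p : Fin n → ℤ}
    {a : Fin n} {q : Fin n → ℤ} (h : pmBm (toSite r) N b p a q ≠ 0) (α : Fin n) : bref α b p - bref α a q ∈ cube n N := by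
  rw [mem_cube]
  intro i
  have k := pmBm_ne_zero hN hr h i
  rw [Pi.sub_apply, bref_apply, bref_apply, abs_le]
  by_cases hiα : i = α
  · rw [if_pos hiα, if_pos hiα]
    by_cases hb : b = α <;> by_cases ha : a = α
    · rw [if_pos hb, if_pos ha]; have := k.2; constructor <;> omega
    · rw [if_pos hb, if_neg ha]; have := k.2; constructor <;> omega
    · rw [if_neg hb, if_pos ha]
      have hib : i ≠ b := fun e => hb (e ▸ hiα)
      have := abs_le.1 (k.1 hib); constructor <;> omega
    · rw [if_neg hb, if_neg ha]
      have := k.2; constructor <;> omega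
  · rw [if_neg hiα, if_neg hiα]
    have := k.2; constructor <;> omega

end

end Summit.QuantumFields.BalabanUV.Beta.AxialDressingRooted
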